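import Summits.QuantumAdvantage.QuantumAdvantage.Theorems.NearExactIsExact.Negative.UntwistedSection

/-!
# `NearExactIsExact` (stmt-QuantumAdvantage-14043) — THEOREM U up to a source shear (gen 40)

Companion to `Negative.UntwistedSection` (THEOREM U: an untwisted `u₅` never realises the flat
residual).  The source shear `(u, w) ↦ (u, w ⊕ u_{i₀}·v₀)` (`v₀ ∈ 𝔽₂ʳ` constant) is an AFFINE map of
`𝔽₂^{6+r}` fixing the flat `{u = 0}` as a set, so pulling the residual identity back along it keeps
`c₁` cubic and the right-hand side `1_{u=0}`; hence THEOREM U applies as soon as SOME shear untwists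
the zero section (`untwisted_shear_residual_ne_flat`).  In the naff = 5 normal form of the b2b cell
(`x₅ = g ⊕ u₅(1⊕λ) ⊕ a(ū)ᵀt`, `y = B⁰ ⊕ u₅B¹ ⊕ (M̄ ⊕ u₅E)t`, DISPROOF.md §46.3/§47.8) the shear
`t ↦ t ⊕ u₅v₀` replaces `(λ, B¹)` by `(λ ⊕ aᵀv₀, B¹ ⊕ (M̄ ⊕ E)v₀)`; so a frame is EMPTY (one-sidedly,
all `r`) whenever `λ(ū) = a(ū)ᵀv₀` and `B¹(ū) ⊕ (M̄(ū) ⊕ E)v₀` is CONSTANT for some `v₀` — e.g. on the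
aligned rank-one frames of the LF programme (`a = ατ`, `κ = 0`): `B¹ ∈ c ⊕ N(ū)v₀` with `τᵀv₀ = [λ = α]`
(DISPROOF.md §47.22; this is the sub-family 'v = M̄⁻¹B¹ constant' of the two-sided census, 16 of the
32 subframes of each of the two LF frames of §47.20).

HONEST FRAMING: the value here is a THEOREM (kernel-checked negative lemma on an infinite sub-family
of the last Maiorana–McFarland habitat of `NearExactIsExact`), NOT summit progress.
-/

set_option linter.dupNamespace false -- D-0017: single-problem summit ⇒ `QuantumAdvantage.QuantumAdvantage` by design

namespace Summit.QuantumAdvantage.QuantumAdvantage.Theorems.NearExactIsExact.Negative.UntwistedShear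

open Finset
open Literature.Computability.QuantumComplexity
open Literature.Computability.QuantumComplexity.BuzetChailloux (bxor)
open Summit.QuantumAdvantage.QuantumAdvantage.Theorems.CubicForrelation.NearExactIsExact
  (fc_isDegLeFun_comp fc_deg_bxor)
open Summit.QuantumAdvantage.QuantumAdvantage.Theorems.NearExactIsExact.Negative.UntwistedSection
  (untwisted_residual_ne_flat)

variable {r : ℕ}

/-! ### THEOREM U up to a source shear `w ↦ w ⊕ u_{i₀}·v₀` -/

/-- The source shear `y = (u, w) ↦ (u, w ⊕ u_{i₀}·v₀)` written on `𝔽₂^{6+r}`, applied to `(u, w)`.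
[folklore] -/
theorem shear_append (i₀ : Fin 6) (v₀ : Fin r → Bool) (u : Fin 6 → Bool) (w : Fin r → Bool) :
    (fun j => Fin.addCases (motive := fun _ => Bool) (fun i => Fin.append u w (Fin.castAdd r i))
        (fun k => Fin.append u w (Fin.natAdd 6 k) ^^ (Fin.append u w (Fin.castAdd r i₀) && v₀ k)) j) =
      Fin.append u (fun k => w k ^^ (u i₀ && v₀ k)) := by
  funext j
  induction j using Fin.addCases with
  | left i => simp
  | right k => simp

/-- The source shear has affine coordinates. [folklore] -/
theorem shear_coord_deg (i₀ : Fin 6) (v₀ : Fin r → Bool) : ∀ j : Fin (6 + r),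
    IsDegLeFun 1 (fun y : Fin (6 + r) → Bool => Fin.addCases (motive := fun _ => Bool)
      (fun i => y (Fin.castAdd r i)) (fun k => y (Fin.natAdd 6 k) ^^ (y (Fin.castAdd r i₀) && v₀ k)) j) := by
  intro j
  induction j using Fin.addCases with
  | left i =>
    simp only [Fin.addCases_left]
    exact isDegLeFun_apply _ le_rfl
  | right k =>
    simp only [Fin.addCases_right]
    cases v₀ k
    · simp only [Bool.and_false, Bool.xor_false]
      exact isDegLeFun_apply _ le_rfl
    · simp only [Bool.and_true]
      exact fc_deg_bxor (isDegLeFun_apply _ le_rfl) (isDegLeFun_apply _ le_rfl)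

/-- **THEOREM U (sheared form, all `r`).** If SOME source shear `w ↦ w ⊕ u_{i₀}·v₀` untwists the map —
the sheared section `u ↦ Φ(u, u_{i₀}·v₀)` is `P(u) ⊕ u_{i₀}·v` with `P` independent of `u_{i₀}`, of
coordinate degree `≤ 2`, and `v` constant — then the residual of `Φ` against any two cubics is not
`1_{u=0}` (pull the identity back along the shear, an affine map fixing the flat, and apply
`untwisted_residual_ne_flat`).  Normal-form reading (DISPROOF.md §47.21–47.22): the frame is EMPTY
whenever `λ(ū) = a(ū)ᵀv₀` and `B¹(ū) ⊕ (M̄(ū) ⊕ E)v₀` is constant for some `v₀ ∈ 𝔽₂⁵`. [folklore] -/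
theorem untwisted_shear_residual_ne_flat (i₀ : Fin 6) (v₀ : Fin r → Bool)
    (P : (Fin 6 → Bool) → (Fin (6 + r) → Bool))
    (hP : ∀ u b, P (Function.update u i₀ b) = P u) (hPd : ∀ j, IsDegLeFun 2 (fun u => P u j))
    (v : Fin (6 + r) → Bool) (Φ : (Fin 6 → Bool) → (Fin r → Bool) → (Fin (6 + r) → Bool))
    (hΦ : ∀ u, Φ u (fun k => u i₀ && v₀ k) = bxor (P u) (fun j => u i₀ && v j))
    (c₁ c₂ : (Fin (6 + r) → Bool) → Bool) (h₁ : IsDegLeFun 3 c₁) (h₂ : IsDegLeFun 3 c₂) :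
    ¬ ∀ (u : Fin 6 → Bool) (w : Fin r → Bool),
      (c₁ (Fin.append u w) ^^ c₂ (Φ u w)) = decide (∀ i, u i = false) := by
  intro h
  have h₁' : IsDegLeFun 3 (fun y : Fin (6 + r) → Bool => c₁ (fun j => Fin.addCases (motive := fun _ => Bool)
      (fun i => y (Fin.castAdd r i)) (fun k => y (Fin.natAdd 6 k) ^^ (y (Fin.castAdd r i₀) && v₀ k)) j)) :=
    fc_isDegLeFun_comp h₁ _ (shear_coord_deg i₀ v₀) (by norm_num)
  refine untwisted_residual_ne_flat i₀ P hP hPd v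
    (fun u w => Φ u (fun k => w k ^^ (u i₀ && v₀ k))) (fun u => ?_) _ c₂ h₁' h₂ (fun u w => ?_)
  · simp only [Bool.false_xor]
    exact hΦ u
  · show (c₁ _ ^^ c₂ (Φ u fun k => w k ^^ (u i₀ && v₀ k))) = _
    rw [shear_append]
    exact h u _

end Summit.QuantumAdvantage.QuantumAdvantage.Theorems.NearExactIsExact.Negative.UntwistedShear
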